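import Mathlib.Algebra.Order.BigOperators.Group.Finset
import Mathlib.Algebra.Order.BigOperators.Ring.Finset
import Mathlib.Algebra.BigOperators.Ring.Finset
import Mathlib.Algebra.Order.Field.Basic
import Mathlib.Data.Finset.Lattice.Fold
import Mathlib.Data.Real.Basic
import Mathlib.Tactic.FieldSimp
import Mathlib.Tactic.Linarith
import Mathlib.Tactic.Positivity
import Mathlib.Tactic.Ring
import HarnessLib

/-!
# The hyperplane separation lower bound for non-negative rank (Fiorini; Rothvoss 2017, Lemma 5)

A fully PROVED, discrete form of the *hyperplane separation lower bound* of T. Rothvoss,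
*The matching polytope has exponential extension complexity*, J. ACM 64 (2017) 41 (arXiv:1311.2369),
**Lemma 5** (credited there to S. Fiorini): if a non-negative matrix `S` on `X₀ × Y₀` has a
non-negative factorisation `S = ∑_{i<r} aᵢ ⊗ bᵢ` with `r` terms, and `W` is any weight matrix whose
mass `⟨W, R⟩ = ∑_{(x,y) ∈ A × B} W x y` on every rectangle `R = A × B` is at most `α`, then
`⟨W, S⟩ ≤ r · ‖S‖_∞ · α`, i.e. `rk₊(S) ≥ ⟨W, S⟩ / (‖S‖_∞ · α)`.

The `-∞` entries of Rothvoss's `W` (p. 6: "completely forbid to cover any entry" where the slack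
vanishes) are modelled by a *forbidden set* `Z ⊆ X × Y` on which `S` vanishes: the rectangle
hypothesis is only required for rectangles avoiding `Z`, which is legitimate because every rank-one
term of a non-negative factorisation vanishes wherever `S` does.

* `sum_mul_mul_le_of_rectangle_bound` — the first half of the printed proof: a bound `α` on
  `Z`-free `0/1` rectangles bounds `⟨W, u ⊗ v⟩` for all FRACTIONAL `u ∈ [0,1]^{X₀}`, `v ∈ [0,1]^{Y₀}`
  with `u_x v_y = 0` on `Z` ("if we fix `y`, this optimization problem is linear in `x` and there is
  always an `x' ∈ {0,1}` that is also optimal" — here realised by the explicit greedy roundings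
  `A = {x : u_x > 0, ∑_y W_{xy} v_y > 0}` and then `B = {y : v_y > 0, ∑_{x ∈ A} W_{xy} > 0}`, which
  keep `Z`-freeness).
* `hyperplane_separation_bound` — Lemma 5 itself: `⟨W, S⟩ ≤ r · L · α` whenever `S ≤ L` on
  `X₀ × Y₀` (normalise `aᵢ`, `bᵢ` by their maxima `αᵢ`, `βᵢ`; `αᵢ βᵢ ≤ ‖S‖_∞` because
  `aᵢ(x*) bᵢ(y*) ≤ S(x*, y*)`).
* `rank_bound_of_corruption` — the two-level specialisation used for the matching polytope
  (Rothvoss 2017, §2, display (2) and Lemma 6 ⇒ Theorem 1): with `W = μ₃ - κ μₖ` for unit masses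
  `μ₃`, `μₖ` supported where `S = s₃`, resp. `S = sₖ`, a *corruption* inequality
  `μ₃(R) ≤ κ μₖ(R) + ε` on `Z`-free rectangles gives `s₃ - κ sₖ ≤ r · L · ε`.

All sums are finite sums over explicit `Finset`s `X₀`, `Y₀` (rows and columns actually used); the
factor functions `a`, `b` and the weights are total functions on the ambient types, as in
`SeparationComplexity.hrubes_separation_rank_bound` and
`MatchingExtensionComplexity.rothvoss_matching_slack_bound`.

## References

* T. Rothvoss, *The matching polytope has exponential extension complexity*, J. ACM 64(6) (2017)
  41:1–41:19, Lemma 5 and §2 [Rothvoss2017].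
-/

namespace Literature.Computability.Complexity

open Finset

variable {X Y : Type*}

/-- **Fractional rectangles are no better than 0/1 rectangles** (first half of the proof of
Rothvoss 2017, Lemma 5). If every `Z`-free rectangle `A × B ⊆ X₀ × Y₀` has `W`-mass `≤ α`, then
for all `u : X → [0,1]`, `v : Y → [0,1]` (bounds needed on `X₀`, `Y₀` only) with `u x · v y = 0`
whenever `(x, y) ∈ Z`, also `∑_{x ∈ X₀} ∑_{y ∈ Y₀} W x y · u x · v y ≤ α`. Proof: greedy rounding,
first of `u` (keep the rows with `u_x > 0` and positive row sum against `v`), then of `v`.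
[cite: Rothvoss2017, Lem. 5] -/
theorem sum_mul_mul_le_of_rectangle_bound (X₀ : Finset X) (Y₀ : Finset Y) (W : X → Y → ℝ)
    (Z : Set (X × Y)) (α : ℝ)
    (hα : ∀ A ⊆ X₀, ∀ B ⊆ Y₀, (∀ x ∈ A, ∀ y ∈ B, (x, y) ∉ Z) →
      ∑ x ∈ A, ∑ y ∈ B, W x y ≤ α)
    (u : X → ℝ) (v : Y → ℝ) (hu0 : ∀ x ∈ X₀, 0 ≤ u x) (hu1 : ∀ x ∈ X₀, u x ≤ 1)
    (hv0 : ∀ y ∈ Y₀, 0 ≤ v y) (hv1 : ∀ y ∈ Y₀, v y ≤ 1)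
    (huv : ∀ x ∈ X₀, ∀ y ∈ Y₀, (x, y) ∈ Z → u x = 0 ∨ v y = 0) :
    ∑ x ∈ X₀, ∑ y ∈ Y₀, W x y * (u x * v y) ≤ α := by
  classical
  -- Step 1: round `u` to the indicator of `A`.
  set c : X → ℝ := fun x => ∑ y ∈ Y₀, W x y * v y with hc
  set A : Finset X := X₀.filter (fun x => 0 < u x ∧ 0 < c x) with hA
  have hAX : A ⊆ X₀ := filter_subset _ _
  have step1 : ∑ x ∈ X₀, ∑ y ∈ Y₀, W x y * (u x * v y) ≤ ∑ x ∈ A, c x := by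
    have e : ∀ x ∈ X₀, ∑ y ∈ Y₀, W x y * (u x * v y) = u x * c x := by
      intro x _
      rw [hc, mul_sum]
      exact sum_congr rfl fun y _ => by ring
    rw [sum_congr rfl e, ← sum_filter_add_sum_filter_not X₀ (fun x => 0 < u x ∧ 0 < c x)]
    have h1 : ∑ x ∈ A, u x * c x ≤ ∑ x ∈ A, c x := by
      refine sum_le_sum fun x hx => ?_
      have hx' := mem_filter.1 hx
      calc u x * c x ≤ 1 * c x := mul_le_mul_of_nonneg_right (hu1 x hx'.1) hx'.2.2.le
        _ = c x := one_mul _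
    have h2 : ∑ x ∈ X₀.filter (fun x => ¬ (0 < u x ∧ 0 < c x)), u x * c x ≤ 0 := by
      refine sum_nonpos fun x hx => ?_
      have hx' := mem_filter.1 hx
      by_cases hux : 0 < u x
      · have hcx : c x ≤ 0 := not_lt.1 fun h => hx'.2 ⟨hux, h⟩
        exact mul_nonpos_of_nonneg_of_nonpos hux.le hcx
      · have hu : u x = 0 := le_antisymm (not_lt.1 hux) (hu0 x hx'.1)
        simp [hu]
    linarith
  -- Step 2: round `v` to the indicator of `B`.
  set d : Y → ℝ := fun y => ∑ x ∈ A, W x y with hd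
  set B : Finset Y := Y₀.filter (fun y => 0 < v y ∧ 0 < d y) with hB
  have hBY : B ⊆ Y₀ := filter_subset _ _
  have step2 : ∑ x ∈ A, c x ≤ ∑ x ∈ A, ∑ y ∈ B, W x y := by
    have e1 : ∑ x ∈ A, c x = ∑ y ∈ Y₀, v y * d y := by
      simp only [hc, hd]
      rw [sum_comm]
      refine sum_congr rfl fun y _ => ?_
      rw [mul_sum]
      exact sum_congr rfl fun x _ => by ring
    have e2 : ∑ x ∈ A, ∑ y ∈ B, W x y = ∑ y ∈ B, d y := by
      simp only [hd]
      rw [sum_comm]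
    rw [e1, e2, ← sum_filter_add_sum_filter_not Y₀ (fun y => 0 < v y ∧ 0 < d y)]
    have h1 : ∑ y ∈ B, v y * d y ≤ ∑ y ∈ B, d y := by
      refine sum_le_sum fun y hy => ?_
      have hy' := mem_filter.1 hy
      calc v y * d y ≤ 1 * d y := mul_le_mul_of_nonneg_right (hv1 y hy'.1) hy'.2.2.le
        _ = d y := one_mul _
    have h2 : ∑ y ∈ Y₀.filter (fun y => ¬ (0 < v y ∧ 0 < d y)), v y * d y ≤ 0 := by
      refine sum_nonpos fun y hy => ?_
      have hy' := mem_filter.1 hy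
      by_cases hvy : 0 < v y
      · have hdy : d y ≤ 0 := not_lt.1 fun h => hy'.2 ⟨hvy, h⟩
        exact mul_nonpos_of_nonneg_of_nonpos hvy.le hdy
      · have hv : v y = 0 := le_antisymm (not_lt.1 hvy) (hv0 y hy'.1)
        simp [hv]
    linarith
  -- Step 3: the rounded rectangle `A × B` avoids `Z`.
  have hAB : ∀ x ∈ A, ∀ y ∈ B, (x, y) ∉ Z := by
    intro x hx y hy hZ
    have hx' := mem_filter.1 hx
    have hy' := mem_filter.1 hy
    rcases huv x hx'.1 y hy'.1 hZ with h | h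
    · exact absurd hx'.2.1 (by simp [h])
    · exact absurd hy'.2.1 (by simp [h])
  exact step1.trans (step2.trans (hα A hAX B hBY hAB))

/-- **Hyperplane separation lower bound** (Rothvoss 2017, Lemma 5, after Fiorini), discrete form.
Let `S = ∑_{i<r} aᵢ ⊗ bᵢ` on `X₀ × Y₀` with `aᵢ, bᵢ ≥ 0`, let `S ≤ L` there (`0 ≤ L`), let `S`
vanish on the forbidden set `Z`, and let every `Z`-free rectangle have `W`-mass `≤ α`. Then
`⟨W, S⟩ = ∑_{x ∈ X₀} ∑_{y ∈ Y₀} W x y · S x y ≤ r · L · α` — that is, `rk₊(S) ≥ ⟨W,S⟩ / (‖S‖_∞ α)`.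
Proof as printed: each rank-one term, normalised by `αᵢ = max aᵢ`, `βᵢ = max bᵢ`, is a fractional
`Z`-free rectangle (`sum_mul_mul_le_of_rectangle_bound`), and `αᵢ βᵢ ≤ ‖S‖_∞`.
[cite: Rothvoss2017, Lem. 5] -/
theorem hyperplane_separation_bound (X₀ : Finset X) (Y₀ : Finset Y) (W S : X → Y → ℝ)
    (Z : Set (X × Y)) (α L : ℝ) (hL : 0 ≤ L)
    (hα : ∀ A ⊆ X₀, ∀ B ⊆ Y₀, (∀ x ∈ A, ∀ y ∈ B, (x, y) ∉ Z) →
      ∑ x ∈ A, ∑ y ∈ B, W x y ≤ α)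
    (hZ : ∀ x ∈ X₀, ∀ y ∈ Y₀, (x, y) ∈ Z → S x y = 0)
    (hSL : ∀ x ∈ X₀, ∀ y ∈ Y₀, S x y ≤ L)
    {r : ℕ} (a : X → Fin r → ℝ) (b : Y → Fin r → ℝ) (ha : ∀ x i, 0 ≤ a x i)
    (hb : ∀ y i, 0 ≤ b y i) (hS : ∀ x ∈ X₀, ∀ y ∈ Y₀, S x y = ∑ i, a x i * b y i) :
    ∑ x ∈ X₀, ∑ y ∈ Y₀, W x y * S x y ≤ r * (L * α) := by
  classical
  have hα0 : 0 ≤ α := by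
    simpa using hα ∅ (empty_subset _) ∅ (empty_subset _) (by simp)
  rcases X₀.eq_empty_or_nonempty with hX | hX
  · simp only [hX, sum_empty]
    positivity
  rcases Y₀.eq_empty_or_nonempty with hY | hY
  · simp only [hY, sum_empty, sum_const_zero]
    positivity
  -- Each rank-one term contributes at most `L * α`.
  have key : ∀ i : Fin r, ∑ x ∈ X₀, ∑ y ∈ Y₀, W x y * (a x i * b y i) ≤ L * α := by
    intro i
    obtain ⟨x₁, hx₁, hx₁eq⟩ := exists_mem_eq_sup' hX (fun x => a x i)
    obtain ⟨y₁, hy₁, hy₁eq⟩ := exists_mem_eq_sup' hY (fun y => b y i)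
    set αi : ℝ := X₀.sup' hX (fun x => a x i) with hαi_def
    set βi : ℝ := Y₀.sup' hY (fun y => b y i) with hβi_def
    have hαi : ∀ x ∈ X₀, a x i ≤ αi := fun x hx => le_sup' (fun x => a x i) hx
    have hβi : ∀ y ∈ Y₀, b y i ≤ βi := fun y hy => le_sup' (fun y => b y i) hy
    have hαi0 : 0 ≤ αi := (ha x₁ i).trans (hαi x₁ hx₁)
    have hβi0 : 0 ≤ βi := (hb y₁ i).trans (hβi y₁ hy₁)
    -- `αᵢ βᵢ ≤ ‖S‖_∞`
    have hprod : αi * βi ≤ L := by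
      rw [hx₁eq, hy₁eq]
      calc a x₁ i * b y₁ i ≤ ∑ j, a x₁ j * b y₁ j :=
            single_le_sum (f := fun j => a x₁ j * b y₁ j)
              (fun j _ => mul_nonneg (ha x₁ j) (hb y₁ j)) (mem_univ i)
        _ = S x₁ y₁ := (hS x₁ hx₁ y₁ hy₁).symm
        _ ≤ L := hSL x₁ hx₁ y₁ hy₁
    by_cases h0 : αi = 0 ∨ βi = 0
    · have hz : ∀ x ∈ X₀, ∀ y ∈ Y₀, a x i * b y i = 0 := by
        intro x hx y hy
        rcases h0 with h | h
        · have : a x i = 0 := le_antisymm (h ▸ hαi x hx) (ha x i)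
          simp [this]
        · have : b y i = 0 := le_antisymm (h ▸ hβi y hy) (hb y i)
          simp [this]
      calc ∑ x ∈ X₀, ∑ y ∈ Y₀, W x y * (a x i * b y i) = 0 :=
            sum_eq_zero fun x hx => sum_eq_zero fun y hy => by rw [hz x hx y hy, mul_zero]
        _ ≤ L * α := mul_nonneg hL hα0
    push Not at h0
    have hαpos : 0 < αi := lt_of_le_of_ne hαi0 (Ne.symm h0.1)
    have hβpos : 0 < βi := lt_of_le_of_ne hβi0 (Ne.symm h0.2)
    -- the normalised term is a fractional `Z`-free rectangle
    have hfrac := sum_mul_mul_le_of_rectangle_bound X₀ Y₀ W Z α hα (fun x => a x i / αi)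
      (fun y => b y i / βi) (fun x _ => div_nonneg (ha x i) hαi0)
      (fun x hx => (div_le_one hαpos).2 (hαi x hx)) (fun y _ => div_nonneg (hb y i) hβi0)
      (fun y hy => (div_le_one hβpos).2 (hβi y hy)) (by
        intro x hx y hy hz
        have h := hZ x hx y hy hz
        rw [hS x hx y hy] at h
        have h' := (sum_eq_zero_iff_of_nonneg fun j _ => mul_nonneg (ha x j) (hb y j)).1 h i
          (mem_univ i)
        rcases mul_eq_zero.1 h' with h'' | h''
        · exact Or.inl (by simp [h''])
        · exact Or.inr (by simp [h'']))
    have e : ∑ x ∈ X₀, ∑ y ∈ Y₀, W x y * (a x i * b y i) =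
        (αi * βi) * ∑ x ∈ X₀, ∑ y ∈ Y₀, W x y * (a x i / αi * (b y i / βi)) := by
      rw [mul_sum]
      refine sum_congr rfl fun x _ => ?_
      rw [mul_sum]
      refine sum_congr rfl fun y _ => ?_
      field_simp
    rw [e]
    calc (αi * βi) * ∑ x ∈ X₀, ∑ y ∈ Y₀, W x y * (a x i / αi * (b y i / βi))
        ≤ (αi * βi) * α := mul_le_mul_of_nonneg_left hfrac (mul_nonneg hαi0 hβi0)
      _ ≤ L * α := mul_le_mul_of_nonneg_right hprod hα0
  calc ∑ x ∈ X₀, ∑ y ∈ Y₀, W x y * S x y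
      = ∑ x ∈ X₀, ∑ y ∈ Y₀, ∑ i, W x y * (a x i * b y i) := by
        refine sum_congr rfl fun x hx => sum_congr rfl fun y hy => ?_
        rw [hS x hx y hy, mul_sum]
    _ = ∑ x ∈ X₀, ∑ i, ∑ y ∈ Y₀, W x y * (a x i * b y i) :=
        sum_congr rfl fun x _ => sum_comm
    _ = ∑ i, ∑ x ∈ X₀, ∑ y ∈ Y₀, W x y * (a x i * b y i) := sum_comm
    _ ≤ ∑ _i : Fin r, L * α := sum_le_sum fun i _ => key i
    _ = r * (L * α) := by simp

/-- **Two-level corruption bound ⇒ non-negative rank bound** (Rothvoss 2017, §2: display (2),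
`⟨W, S⟩ = 1`, and "Lemma 6 ⇒ Theorem 1" via Lemma 5, in abstract form). Let `S = ∑_{i<r} aᵢ ⊗ bᵢ`
(`aᵢ, bᵢ ≥ 0`) on `X₀ × Y₀`, `S ≤ L`, `S = 0` on `Z`. Let `μ₃`, `μₖ` be weights of total mass `1`
on `X₀ × Y₀`, supported on entries with `S = s₃`, resp. `S = sₖ`, and suppose the corruption
inequality `μ₃(A × B) ≤ κ · μₖ(A × B) + ε` for all `Z`-free rectangles (`0 ≤ κ`). Then with
`W = μ₃ - κ μₖ`: `⟨W, S⟩ = s₃ - κ sₖ ≤ r · L · ε`. For the perfect matching polytope `s₃ = 2`,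
`sₖ = k - 1`, `κ = 1/(k-1)`, `ε = 2^{-δ n}`, `L = n`, giving `r ≥ 2^{δ n}/n`.
[cite: Rothvoss2017, Lem. 5–6 and (2)] -/
theorem rank_bound_of_corruption (X₀ : Finset X) (Y₀ : Finset Y) (S : X → Y → ℝ)
    (Z : Set (X × Y)) (μ₃ μₖ : X → Y → ℝ) (κ ε L s₃ sₖ : ℝ) (hL : 0 ≤ L)
    (h₃S : ∀ x ∈ X₀, ∀ y ∈ Y₀, μ₃ x y ≠ 0 → S x y = s₃)
    (hₖS : ∀ x ∈ X₀, ∀ y ∈ Y₀, μₖ x y ≠ 0 → S x y = sₖ)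
    (h₃1 : ∑ x ∈ X₀, ∑ y ∈ Y₀, μ₃ x y = 1) (hₖ1 : ∑ x ∈ X₀, ∑ y ∈ Y₀, μₖ x y = 1)
    (hcorr : ∀ A ⊆ X₀, ∀ B ⊆ Y₀, (∀ x ∈ A, ∀ y ∈ B, (x, y) ∉ Z) →
      ∑ x ∈ A, ∑ y ∈ B, μ₃ x y ≤ κ * ∑ x ∈ A, ∑ y ∈ B, μₖ x y + ε)
    (hZ : ∀ x ∈ X₀, ∀ y ∈ Y₀, (x, y) ∈ Z → S x y = 0)
    (hSL : ∀ x ∈ X₀, ∀ y ∈ Y₀, S x y ≤ L)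
    {r : ℕ} (a : X → Fin r → ℝ) (b : Y → Fin r → ℝ) (ha : ∀ x i, 0 ≤ a x i)
    (hb : ∀ y i, 0 ≤ b y i) (hS : ∀ x ∈ X₀, ∀ y ∈ Y₀, S x y = ∑ i, a x i * b y i) :
    s₃ - κ * sₖ ≤ r * (L * ε) := by
  have hW := hyperplane_separation_bound X₀ Y₀ (fun x y => μ₃ x y - κ * μₖ x y) S Z ε L hL
    (by
      intro A hA B hB hAB
      have h := hcorr A hA B hB hAB
      have e : ∑ x ∈ A, ∑ y ∈ B, (μ₃ x y - κ * μₖ x y) =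
          ∑ x ∈ A, ∑ y ∈ B, μ₃ x y - κ * ∑ x ∈ A, ∑ y ∈ B, μₖ x y := by
        rw [mul_sum, ← sum_sub_distrib]
        refine sum_congr rfl fun x _ => ?_
        rw [mul_sum, ← sum_sub_distrib]
      rw [e]
      linarith)
    hZ hSL a b ha hb hS
  have e3 : ∀ x ∈ X₀, ∀ y ∈ Y₀, μ₃ x y * S x y = μ₃ x y * s₃ := by
    intro x hx y hy
    by_cases h : μ₃ x y = 0
    · simp [h]
    · rw [h₃S x hx y hy h]
  have ek : ∀ x ∈ X₀, ∀ y ∈ Y₀, μₖ x y * S x y = μₖ x y * sₖ := by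
    intro x hx y hy
    by_cases h : μₖ x y = 0
    · simp [h]
    · rw [hₖS x hx y hy h]
  have e : ∑ x ∈ X₀, ∑ y ∈ Y₀, (μ₃ x y - κ * μₖ x y) * S x y = s₃ - κ * sₖ := by
    calc ∑ x ∈ X₀, ∑ y ∈ Y₀, (μ₃ x y - κ * μₖ x y) * S x y
        = ∑ x ∈ X₀, ∑ y ∈ Y₀, (μ₃ x y * s₃ - κ * (μₖ x y * sₖ)) :=
          sum_congr rfl fun x hx => sum_congr rfl fun y hy => by
            rw [sub_mul, mul_assoc, e3 x hx y hy, ek x hx y hy]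
      _ = (∑ x ∈ X₀, ∑ y ∈ Y₀, μ₃ x y) * s₃ - κ * ((∑ x ∈ X₀, ∑ y ∈ Y₀, μₖ x y) * sₖ) := by
          simp only [sum_sub_distrib, sum_mul, mul_sum]
      _ = s₃ - κ * sₖ := by rw [h₃1, hₖ1, one_mul, one_mul]
  rw [e] at hW
  exact hW

end Literature.Computability.Complexity
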